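import Summits.Parity.GeneralizedHardyLittlewood.Theorems.PrimeLevelFamEdgeMomentsBeyondDiagonalDiagBoseMixedRemainder
import HarnessLib

/-!
# Route `PrimeLevelFamEdge`, crux K_A `MomentsBeyondDiagonal` (stmt-Parity-20007), line «petersson_layers» v4, stub `stub_diag`:
# **census R2 — the zeroth model moment `μ₀ = ∫₀¹ v/(1+v²)² dv = 1/4` and the top coefficient of `P_ab`**

In `…DiagBoseMixedStructure.bose_coeff_structure` the polynomial part of the Bose coefficient `c_ab` has coefficients
`C(a,i)C(b,j)((−1)^j+(−1)^i) μ_{i+j} (−1/2)^{a−i+b−j}/(a−i+b−j+1)`, `μ_k = ∫₀¹(log v)^k v/(1+v²)² dv`. Its top-degree term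
(`i = j = 0`) is `2μ₀(−1/2)^{a+b} L^{a+b+1}/(a+b+1)`; with

* `integral_model_weight_Ioc` — **`μ₀ = ∫₀¹ v/(1+v²)² dv = 1/4`**,

this is `(−1)^{a+b} 2^{−(a+b+1)} L^{a+b+1}/(a+b+1)`, the leading term found independently in
`…DiagBoseMixedLeading.bose_coeff_leading` (p819400) — the two descriptions of `c_ab` agree at top order.

* `top_coeff_eq` — the arithmetic identity `2·(1/4)·(−1/2)^n/(n+1) = (−1)^n/2^{n+1}/(n+1)`.

Def-free; theorems only. Helper `--supports stmt-Parity-20007`; closes nothing; K_A, K_B and the Parity summit are NOT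
proved; nothing about Landau–Siegel zeros.

## References
* E. Kowalski, P. Michel, J. VanderKam, J. reine angew. Math. 526 (2000), (22)–(28) pp. 12–15.
  [cite: KowalskiMichelVanderKam2000, (22)–(28) — derivation (residues of the diagonal weight, real-variable form)]
-/

noncomputable section

open Real Set MeasureTheory intervalIntegral

namespace Summit.Parity.GeneralizedHardyLittlewood.Theorems.MomentsBeyondDiagonal.DiagLines

/-- **`∫₀¹ v/(1+v²)² dv = 1/4`** (antiderivative `−1/(2(1+v²))`). [folklore] -/
theorem integral_model_weight_Ioc : ∫ v in Ioc (0 : ℝ) 1, v / (1 + v ^ 2) ^ 2 = 1 / 4 := by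
  rw [← intervalIntegral.integral_of_le zero_le_one]
  have hderiv : ∀ v ∈ uIcc (0 : ℝ) 1, HasDerivAt (fun v : ℝ ↦ -(1 / (2 * (1 + v ^ 2)))) (v / (1 + v ^ 2) ^ 2) v := by
    intro v _
    have h0 : (2 * (1 + v ^ 2)) ≠ 0 := by positivity
    have h1 : HasDerivAt (fun v : ℝ ↦ 2 * (1 + v ^ 2)) (2 * (2 * v)) v := by
      have := ((hasDerivAt_pow 2 v).const_add 1).const_mul 2
      simpa using this
    have h2 := (h1.inv h0).neg
    refine h2.congr_of_eventuallyEq ?_ |>.congr_deriv ?_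
    · exact Filter.Eventually.of_forall fun x ↦ by simp [one_div]
    · field_simp
  have hcont : ContinuousOn (fun v : ℝ ↦ v / (1 + v ^ 2) ^ 2) (uIcc 0 1) :=
    ContinuousOn.div continuousOn_id ((continuousOn_const.add (continuousOn_pow 2)).pow 2) fun v _ ↦ by positivity
  rw [integral_eq_sub_of_hasDerivAt hderiv hcont.intervalIntegrable]
  norm_num

/-- The top coefficient of `P_ab`: `2·(1/4)·(−1/2)^n/(n+1) = (−1)^n/2^{n+1}/(n+1)`. [folklore] -/
theorem top_coeff_eq (n : ℕ) :
    2 * (1 / 4 : ℝ) * (-1 / 2) ^ n / ((n : ℝ) + 1) = (-1) ^ n / 2 ^ (n + 1) / ((n : ℝ) + 1) := by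
  rw [div_pow, pow_succ]
  field_simp
  ring

end Summit.Parity.GeneralizedHardyLittlewood.Theorems.MomentsBeyondDiagonal.DiagLines

end
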